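/-
Origin: expansion seat `planner-pub-hodgecm-toy-g2-0`, handover #5 2026-08-18T06:32:31Z (`HOME/pub-hodgecm-toy-g2/lean/ToyG2/RiemannSystem.lean`, md5 7e4de9a6, 199 lines);
landed by the gen-7 packager in gate run 25 as `HodgeCM/Model/ToyG2/RiemannSystem.lean` (import ^import ToyG2\.→import HodgeCM.Model.ToyG2. ×2).
-/
/-
Copyright: HodgeCMPerL referee-model cell (toy lineage, generation 2).  Lean 4 / Mathlib.
-/
import Mathlib
import Summits.HodgeConjecture.HodgeCM.CM.Basic
import Summits.HodgeConjecture.HodgeCM.Model.ToyG2.Polarization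
import Summits.HodgeConjecture.HodgeCM.Model.ToyG2.BlockGram_2

/-!
# ToyG2 — Riemann systems: `PairSum Θ ⇒` Riemann elements `ξ₀, ξ₁, ξ₂, ξ₃` with `ξ₀ξ₁ = ξ₂ξ₃`

DESIGN.md §3, KEY IDENTITY.  For a CM field `F` and a quadruple of CM types `Θ : Fin 4 → CMType F` satisfying the pair-sum
(tetrahedron) identity `HodgeCM.PairSum Θ`, there are `ξ i ∈ F` with `ξ̄ᵢ = -ξᵢ`, `θ(ξᵢ) ∈ iℝ`, `Im θ(ξᵢ) > 0 ⟺ θ ∈ Θᵢ` AND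
`ξ₀ ξ₁ = ξ₂ ξ₃` (`exists_riemannSystem`).

Construction: `ξᵢ := ξ · ∏_{v ∈ D(Θᵢ)} π_v`, where `ξ` is a Riemann element of `Θ₀` (`exists_riemannElement`), `π_v ∈ F⁺` is negative
exactly over the place `v` (`exists_real_neg_exactly_at`), and `D(Θ) = diffPlaces Θ₀ Θ` is the set of places over which `Θ` and `Θ₀`
differ.  Pair-sum gives `D(Θ₁) = D(Θ₂) ⊔ D(Θ₃)` (`diffPlaces_pairSum`), whence the multiplicative identity.

Then `blockData` packages `(conjugate, Θ, s i θ := Im θ(ξᵢ), β, d := 2)` as a `BlockData (F →+* ℂ)` (BlockGram.lean), so that the explicit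
Gram map / kernel relation / non-vanishing of `BlockGram` apply to every pair-sum quadruple — in particular to PerL's induced types and to
the period types `Face.psi f` of a face (`HodgeCM.pairSum_psi`).

No placeholders, no new axioms.
-/

noncomputable section

namespace HodgeCM.ToyG2

open NumberField NumberField.InfinitePlace NumberField.ComplexEmbedding
open Literature.AlgebraicGeometry.ShimuraVarieties (conjRingHomK embedding_conjRingHomK)
open Literature.AlgebraicGeometry.Motives (CMType)
open scoped Classical

variable {F : CMField}

/-- The places over which the CM type `Θ` differs from the reference type `Θ₀`. -/
def diffPlaces (Θ₀ Θ : CMType F) : Finset (InfinitePlace F) :=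
  Finset.univ.filter fun v => ¬ (v.embedding ∈ Θ.1 ↔ v.embedding ∈ Θ₀.1)

/-- (Ported verbatim from the HodgeCMPerL package; no docstring in the source.) -/
theorem mem_diffPlaces {Θ₀ Θ : CMType F} {v : InfinitePlace F} :
    v ∈ diffPlaces Θ₀ Θ ↔ ¬ (v.embedding ∈ Θ.1 ↔ v.embedding ∈ Θ₀.1) := by
  simp [diffPlaces]

/-- (Ported verbatim from the HodgeCMPerL package; no docstring in the source.) -/
theorem diffPlaces_self (Θ₀ : CMType F) : diffPlaces Θ₀ Θ₀ = ∅ := by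
  ext v; simp [mem_diffPlaces]

/-- Membership of the place of `θ` in `D(Θ)`, read at `θ` itself (either representative of the place will do). -/
theorem mk_mem_diffPlaces_iff {Θ₀ Θ : CMType F} (θ : F →+* ℂ) :
    InfinitePlace.mk θ ∈ diffPlaces Θ₀ Θ ↔ ¬ (θ ∈ Θ.1 ↔ θ ∈ Θ₀.1) := by
  rw [mem_diffPlaces]
  rcases embedding_mk_eq θ with h | h
  · rw [h]
  · rw [h, CMTypeOps.conjugate_mem_iff_notMem, CMTypeOps.conjugate_mem_iff_notMem]
    tauto

/-- **Pair-sum ⇒ `D(Θ₁) = D(Θ₂) ⊔ D(Θ₃)`** (relative to `Θ₀`). -/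
theorem diffPlaces_pairSum (Θ : Fin 4 → CMType F) (h : PairSum Θ) :
    diffPlaces (Θ 0) (Θ 1) = diffPlaces (Θ 0) (Θ 2) ∪ diffPlaces (Θ 0) (Θ 3) ∧
      Disjoint (diffPlaces (Θ 0) (Θ 2)) (diffPlaces (Θ 0) (Θ 3)) := by
  have key : ∀ e : F →+* ℂ,
      ((¬ (e ∈ (Θ 1).1 ↔ e ∈ (Θ 0).1)) ↔
        (¬ (e ∈ (Θ 2).1 ↔ e ∈ (Θ 0).1) ∨ ¬ (e ∈ (Θ 3).1 ↔ e ∈ (Θ 0).1))) ∧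
      ¬ (¬ (e ∈ (Θ 2).1 ↔ e ∈ (Θ 0).1) ∧ ¬ (e ∈ (Θ 3).1 ↔ e ∈ (Θ 0).1)) := by
    intro e
    have hv := h e
    simp only [HodgeCM.ind] at hv
    by_cases h0 : e ∈ (Θ 0).1 <;> by_cases h1 : e ∈ (Θ 1).1 <;> by_cases h2 : e ∈ (Θ 2).1 <;>
      by_cases h3 : e ∈ (Θ 3).1 <;> simp [h0, h1, h2, h3] at hv ⊢
  constructor
  · ext v
    rw [Finset.mem_union, mem_diffPlaces, mem_diffPlaces, mem_diffPlaces]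
    exact (key v.embedding).1
  · rw [Finset.disjoint_left]
    intro v h2 h3
    rw [mem_diffPlaces] at h2 h3
    exact (key v.embedding).2 ⟨h2, h3⟩

/-- The imaginary part of a Riemann element never vanishes. -/
theorem im_ne_zero_of_riemann {Θ₀ : CMType F} {ξ : F}
    (hξ : ∀ θ : F →+* ℂ, (θ ξ).re = 0 ∧ (0 < (θ ξ).im ↔ θ ∈ Θ₀.1)) (θ : F →+* ℂ) : (θ ξ).im ≠ 0 := by
  intro h0
  by_cases hθ : θ ∈ Θ₀.1
  · have h1 := (hξ θ).2.mpr hθ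
    rw [h0] at h1
    exact lt_irrefl _ h1
  · have hc : conjugate θ ∈ Θ₀.1 := (CMTypeOps.conjugate_mem_iff_notMem _ _).mpr hθ
    have h1 := (hξ (conjugate θ)).2.mpr hc
    rw [conjugate_coe_eq, Complex.conj_im, h0, neg_zero] at h1
    exact lt_irrefl _ h1

/-- **Riemann systems.** -/
theorem exists_riemannSystem (Θ : Fin 4 → CMType F) (h : PairSum Θ) :
    ∃ ξ : Fin 4 → F, (∀ i, conjRingHomK F (ξ i) = -ξ i) ∧ (∀ i (θ : F →+* ℂ), (θ (ξ i)).re = 0) ∧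
      (∀ i (θ : F →+* ℂ), (0 < (θ (ξ i)).im ↔ θ ∈ (Θ i).1)) ∧ ξ 0 * ξ 1 = ξ 2 * ξ 3 := by
  obtain ⟨ξ, hξc, hξ⟩ := exists_riemannElement F (Θ 0)
  choose π hπc hπ using fun v : InfinitePlace F => exists_real_neg_exactly_at F v
  obtain ⟨a, ha⟩ : ∃ a : Fin 4 → F, ∀ i, a i = ∏ v ∈ diffPlaces (Θ 0) (Θ i), π v := ⟨_, fun i => rfl⟩
  -- `θ (a i)` is the real number `r = ∏ Re θ(π_v)`
  have hθa : ∀ (i : Fin 4) (θ : F →+* ℂ),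
      θ (a i) = ((∏ v ∈ diffPlaces (Θ 0) (Θ i), (θ (π v)).re : ℝ) : ℂ) := by
    intro i θ
    rw [ha, map_prod, Complex.ofReal_prod]
    refine Finset.prod_congr rfl fun v _ => ?_
    apply Complex.ext <;> simp [(hπ v θ).1]
  -- sign of `r`
  have hr : ∀ (i : Fin 4) (θ : F →+* ℂ),
      (0 < ∏ v ∈ diffPlaces (Θ 0) (Θ i), (θ (π v)).re ↔ InfinitePlace.mk θ ∉ diffPlaces (Θ 0) (Θ i)) ∧
      (∏ v ∈ diffPlaces (Θ 0) (Θ i), (θ (π v)).re) ≠ 0 := by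
    intro i θ
    have hpos : ∀ v, v ≠ InfinitePlace.mk θ → 0 < (θ (π v)).re := by
      intro v hv
      obtain ⟨-, hne, hiff⟩ := hπ v θ
      have : ¬ (θ (π v)).re < 0 := fun hlt => hv (hiff.mp hlt).symm
      exact lt_of_le_of_ne (not_lt.mp this) hne.symm
    by_cases hm : InfinitePlace.mk θ ∈ diffPlaces (Θ 0) (Θ i)
    · have hsplit := Finset.mul_prod_erase (diffPlaces (Θ 0) (Θ i)) (fun v => (θ (π v)).re) hm
      have hrest : 0 < ∏ v ∈ (diffPlaces (Θ 0) (Θ i)).erase (InfinitePlace.mk θ), (θ (π v)).re :=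
        Finset.prod_pos fun v hv => hpos v (Finset.ne_of_mem_erase hv)
      have hneg : (θ (π (InfinitePlace.mk θ))).re < 0 := (hπ _ θ).2.2.mpr rfl
      have hprod : (∏ v ∈ diffPlaces (Θ 0) (Θ i), (θ (π v)).re) < 0 := by
        rw [← hsplit]
        exact mul_neg_of_neg_of_pos hneg hrest
      exact ⟨⟨fun hp => absurd hp (not_lt.mpr hprod.le), fun hn => absurd hm hn⟩, hprod.ne⟩
    · have hp : 0 < ∏ v ∈ diffPlaces (Θ 0) (Θ i), (θ (π v)).re :=
        Finset.prod_pos fun v hv => hpos v (fun e => hm (e ▸ hv))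
      exact ⟨⟨fun _ => hm, fun _ => hp⟩, hp.ne'⟩
  refine ⟨fun i => ξ * a i, fun i => ?_, fun i θ => ?_, fun i θ => ?_, ?_⟩
  · -- `ξ̄ᵢ = -ξᵢ`
    have hac : conjRingHomK F (a i) = a i := by
      rw [ha, map_prod]
      exact Finset.prod_congr rfl fun v _ => hπc v
    rw [map_mul, hξc, hac, neg_mul]
  · -- `Re θ(ξᵢ) = 0`
    rw [map_mul, hθa, Complex.mul_re, (hξ θ).1, Complex.ofReal_re, Complex.ofReal_im]
    ring
  · -- `Im θ(ξᵢ) > 0 ⟺ θ ∈ Θᵢ`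
    rw [map_mul, hθa, Complex.mul_im, (hξ θ).1, Complex.ofReal_re, Complex.ofReal_im, zero_mul, zero_add]
    obtain ⟨hrpos, hrne⟩ := hr i θ
    have hDi : InfinitePlace.mk θ ∈ diffPlaces (Θ 0) (Θ i) ↔ ¬ (θ ∈ (Θ i).1 ↔ θ ∈ (Θ 0).1) :=
      mk_mem_diffPlaces_iff θ
    have hs : 0 < (θ ξ).im ↔ θ ∈ (Θ 0).1 := (hξ θ).2
    have hsne : (θ ξ).im ≠ 0 := im_ne_zero_of_riemann hξ θ
    have hs' : (θ ξ).im < 0 ↔ ¬ 0 < (θ ξ).im :=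
      ⟨fun hl => not_lt.mpr hl.le, fun hn => lt_of_le_of_ne (not_lt.mp hn) hsne⟩
    have hr' : (∏ v ∈ diffPlaces (Θ 0) (Θ i), (θ (π v)).re) < 0 ↔
        ¬ 0 < ∏ v ∈ diffPlaces (Θ 0) (Θ i), (θ (π v)).re :=
      ⟨fun hl => not_lt.mpr hl.le, fun hn => lt_of_le_of_ne (not_lt.mp hn) hrne⟩
    rw [mul_pos_iff, hs', hr', hs, hrpos, hDi]
    by_cases hA : θ ∈ (Θ 0).1 <;> by_cases hI : θ ∈ (Θ i).1 <;> simp only [hA, hI] <;> simp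
  · -- `ξ₀ξ₁ = ξ₂ξ₃`
    obtain ⟨hU, hDis⟩ := diffPlaces_pairSum Θ h
    have ha0 : a 0 = 1 := by rw [ha, diffPlaces_self, Finset.prod_empty]
    have ha1 : a 1 = a 2 * a 3 := by rw [ha, ha 2, ha 3, hU, Finset.prod_union hDis]
    show ξ * a 0 * (ξ * a 1) = ξ * a 2 * (ξ * a 3)
    rw [ha0, ha1]; ring

/-! ### The block data of a pair-sum quadruple -/

/-- The `BlockData` (BlockGram.lean) of a quadruple of CM types with a Riemann system `ξ`: `c = conjugate`,
`s i θ = Im θ(ξᵢ)`, couplings `β k = ε k · s₂ s₃` for a sign choice `ε`, and `d = 2`. -/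
def blockData (Θ : Fin 4 → CMType F) (ξ : Fin 4 → F) (hre : ∀ i (θ : F →+* ℂ), (θ (ξ i)).re = 0)
    (him : ∀ i (θ : F →+* ℂ), (0 < (θ (ξ i)).im ↔ θ ∈ (Θ i).1)) (hmul : ξ 0 * ξ 1 = ξ 2 * ξ 3)
    (ε : Fin 3 → ℝ) (hε : ∀ k, ε k ^ 2 = 1) : BlockData (F →+* ℂ) where
  c := conjugate
  Θ i := Finset.univ.filter fun θ => θ ∈ (Θ i).1
  s i θ := (θ (ξ i)).im
  s_pos_iff i θ := by simp [him]
  s_c i θ := by simp [conjugate_coe_eq]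
  s_mul θ := by
    have h1 := congrArg (fun x : F => (θ x).re) hmul
    simp only [map_mul, Complex.mul_re, hre, zero_mul, zero_sub] at h1
    linarith
  β k θ := ε k * ((θ (ξ 2)).im * (θ (ξ 3)).im)
  β_sq k θ := by rw [mul_pow, hε, one_mul]
  d := 2
  one_le_d := by norm_num

/-- For an embedding `ι` lying in all four types, the couple `(0,1)/(2,3)` at `ι` is present:
`P 0 ι` holds, so `BlockData.g_sec_zero_eq_smul` (kernel relation) and `BlockData.g_fst_ne_zero` apply at `ι`. -/
theorem blockData_P_zero (Θ : Fin 4 → CMType F) (ξ : Fin 4 → F) (hre : ∀ i (θ : F →+* ℂ), (θ (ξ i)).re = 0)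
    (him : ∀ i (θ : F →+* ℂ), (0 < (θ (ξ i)).im ↔ θ ∈ (Θ i).1)) (hmul : ξ 0 * ξ 1 = ξ 2 * ξ 3)
    (ε : Fin 3 → ℝ) (hε : ∀ k, ε k ^ 2 = 1) {ι : F →+* ℂ} (hι : ∀ i, ι ∈ (Θ i).1) :
    (blockData Θ ξ hre him hmul ε hε).P 0 ι := by
  simp [BlockData.P, BlockData.valid, BlockData.fst, BlockData.sec, BlockData.τ, sh₁, sh₂, blockData, hι]

/-- **Existence of block data for every pair-sum quadruple** (the two `OpenInputs` cases: PerL's induced types, and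
`Face.psi f` by `HodgeCM.pairSum_psi`). -/
theorem exists_blockData (Θ : Fin 4 → CMType F) (h : PairSum Θ) :
    ∃ X : BlockData (F →+* ℂ), X.c = conjugate ∧ (∀ i θ, θ ∈ X.Θ i ↔ θ ∈ (Θ i).1) ∧ X.coef 0 = 1 ∧
      ∀ ι : F →+* ℂ, (∀ i, ι ∈ (Θ i).1) → X.P 0 ι := by
  obtain ⟨ξ, -, hre, him, hmul⟩ := exists_riemannSystem Θ h
  refine ⟨blockData Θ ξ hre him hmul (fun _ => 1) (fun _ => by norm_num), rfl, fun i θ => by simp [blockData],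
    by simp [BlockData.coef], fun ι hι => blockData_P_zero Θ ξ hre him hmul _ _ hι⟩

end HodgeCM.ToyG2

end
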